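import Mathlib
import HarnessLib
import Literature.Analysis.FluidPDE.ClassicalSolution
import Literature.Analysis.FluidPDE.VectorCalculus
import Summits.NavierStokesRegularity.NavierStokesRegularity.Theorems.UnthreadedRigidityDoorUnthreadedRigidityPressureHornSupports

/-!
# Route `UnthreadedRigidityDoor`, item `UnthreadedRigidity` (W2, stmt-NavierStokesRegularity-27585) — LINE g10-1 «PRESSURE HORN»: support S-A
# `AnalyticWedgeSeparable` — an admissible, entrywise-analytic family of forms with vanishing wedge is GLOBALLY SEPARABLE (sorry-free)

Cell ns-regularity-ideate, K2 hand ns-poloidal-K2-p2 g13 (DIRECTOR-NS KEY-NS #186 / #281); statement = the Prop `AnalyticWedgeSeparable` of the Theorems-side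
twin `…Theorems.UnthreadedRigidity.PressureHorn` (body VERBATIM from planner ns-idea-6 g10's `PressureHorn_sketch.lean` v1.1: «S-A (support, S; real analysis,
provable now)»).  Three steps.

1. ALGEBRA — INJECTIVITY OF THE WEDGE (`wedge_parallel`): for trace-free symmetric `A, B` with `det[y, Ay, By] = 0` for every `y`,
   `|A|²·B = ⟪A,B⟫·A` (so `B ∥ A` whenever `A ≠ 0`).  Proof: the ten values of the cubic at `y ∈ {eᵢ, eᵢ ± eⱼ, e₁+e₂+e₃}` are bilinear forms in the
   entries, and each component of `|A|²B − ⟪A,B⟫A` is an explicit combination of them with cofactors LINEAR in `A` (ideal membership found by a Gröbner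
   computation, kit j324745 / j324768; certified here by `linear_combination`, i.e. by `ring`).
2. CALCULUS — LOCAL PROPAGATION (Grönwall): with `C := Q(r₀) ≠ 0`, every `2 × 2` minor `w(r) = Q_a(r)C_b − Q_b(r)C_a` satisfies `|Q|²·w′ = ⟪Q,Q′⟫·w` on
   `(0,∞)` (step 1 at each radius, `Q′` trace-free symmetric as the derivative of such a family), hence `|w′| ≤ K|w|` on a short interval `[r₀, r₀+η]` where
   `|Q|² ≥ |C|²/2`; `w(r₀) = 0` and `Mathlib`'s `norm_le_gronwallBound_of_norm_deriv_right_le` give `w ≡ 0` there.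
3. ANALYTIC CONTINUATION: `w` is analytic on the preconnected `(0,∞)` and vanishes on an open interval, so `w ≡ 0` on `(0,∞)`
   (`AnalyticOnNhd.eqOn_zero_of_preconnected_of_eventuallyEq_zero`); continuity at `0` (the smooth-even model `Q(r) = q(r²)`) extends to `r = 0`.  With
   `c := C_{i₀j₀} ≠ 0`, `H(r) := Q_{i₀j₀}(r)/c` is horn-admissible (`h = q_{i₀j₀}/c`, decay constants divided by `|c|`) and `Q(r) = H(r)•C` for `r ≥ 0`.
   If instead `Q ≡ 0` on `(0,∞)`, then `Q(0) = 0` by continuity and `H = 0`, `Q₀ = 0` serve.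

HONEST LABEL: one S-sized support of one line on the wall item (it removes the hypothesis `AnalyticWedgeSeparable` from `isotypicWindowRigidity_of_bridges`);
⟨27585⟩ / W2 OPEN; NS regularity NOT proved.
-/

noncomputable section

-- the summit and its single sub-problem share the name (CONVENTIONS §1), as in every Theorems file
set_option linter.dupNamespace false

namespace Summit.NavierStokesRegularity.NavierStokesRegularity.Theorems.UnthreadedRigidity.PressureHorn

open Set Function Filter Topology Metric
open Summit.NavierStokesRegularity.NavierStokesRegularity.Theorems.UnthreadedRigidity.ProfileHorn

/-! ## Step 1 — injectivity of the wedge on trace-free symmetric forms -/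

/-- **Injectivity of the wedge**: for trace-free symmetric `A, B` with `det[y, Ay, By] ≡ 0`, `|A|²·B = ⟪A,B⟫·A` entrywise.  The cofactors (linear in `A`) were
found by Gröbner reduction (kit j324768) and are certified by `ring`. -/
theorem wedge_parallel {A B : Matrix (Fin 3) (Fin 3) ℝ} (hA : IsQuadForm A) (hB : IsQuadForm B) (h : ∀ y : E3, wedgeDet A B y = 0)
    (i j : Fin 3) : (∑ k, ∑ l, A k l * A k l) * B i j = (∑ k, ∑ l, A k l * B k l) * A i j := by
  have hAs : ∀ k l : Fin 3, A l k = A k l := fun k l => by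
    have := hA.1
    unfold Matrix.IsSymm at this
    exact (congrFun (congrFun this k) l)
  have hBs : ∀ k l : Fin 3, B l k = B k l := fun k l => by
    have := hB.1
    unfold Matrix.IsSymm at this
    exact (congrFun (congrFun this k) l)
  have hA22 : A 2 2 = -A 0 0 - A 1 1 := by
    have := hA.2
    rw [Matrix.trace, Fin.sum_univ_three] at this
    simp only [Matrix.diag_apply] at this
    linarith
  have hB22 : B 2 2 = -B 0 0 - B 1 1 := by
    have := hB.2
    rw [Matrix.trace, Fin.sum_univ_three] at this
    simp only [Matrix.diag_apply] at this
    linarith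
  have hA10 := hAs 0 1
  have hA20 := hAs 0 2
  have hA21 := hAs 1 2
  have hB10 := hBs 0 1
  have hB20 := hBs 0 2
  have hB21 := hBs 1 2
  -- the ten evaluations
  have ev : ∀ p q r : ℝ, wedgeDet A B (WithLp.toLp 2 ![p, q, r]) = 0 := fun p q r => h _
  have key : ∀ p q r : ℝ,
      p * (A 1 0 * p + A 1 1 * q + A 1 2 * r) * (B 2 0 * p + B 2 1 * q + B 2 2 * r)
        - p * (A 2 0 * p + A 2 1 * q + A 2 2 * r) * (B 1 0 * p + B 1 1 * q + B 1 2 * r)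
        - q * (A 0 0 * p + A 0 1 * q + A 0 2 * r) * (B 2 0 * p + B 2 1 * q + B 2 2 * r)
        + q * (A 2 0 * p + A 2 1 * q + A 2 2 * r) * (B 0 0 * p + B 0 1 * q + B 0 2 * r)
        + r * (A 0 0 * p + A 0 1 * q + A 0 2 * r) * (B 1 0 * p + B 1 1 * q + B 1 2 * r)
        - r * (A 1 0 * p + A 1 1 * q + A 1 2 * r) * (B 0 0 * p + B 0 1 * q + B 0 2 * r) = 0 := by
    intro p q r
    have h1 := ev p q r
    rw [wedgeDet_eq] at h1
    simp only [Matrix.mulVec, dotProduct, Fin.sum_univ_three, Matrix.cons_val_zero, Matrix.cons_val_one,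
      Matrix.cons_val_two, Matrix.head_cons, Matrix.tail_cons] at h1
    linear_combination h1
  have h0 := key 1 0 0
  have h1 := key 0 1 0
  have h2 := key 0 0 1
  have h3 := key 1 1 0
  have h4 := key 1 0 1
  have h5 := key 0 1 1
  have h6 := key 1 (-1) 0
  have h7 := key 1 0 (-1)
  have h8 := key 0 1 (-1)
  have h9 := key 1 1 1
  rw [hA10, hA20, hA21, hA22, hB10, hB20, hB21, hB22] at h0 h1 h2 h3 h4 h5 h6 h7 h8 h9
  -- the five free components
  have t00 : ((A 0 0)^2 + (A 0 1)^2 + (A 0 2)^2 + (A 0 1)^2 + (A 1 1)^2 + (A 1 2)^2 + (A 0 2)^2 + (A 1 2)^2 + (-A 0 0 - A 1 1)^2) * B 0 0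
      = (A 0 0 * B 0 0 + A 0 1 * B 0 1 + A 0 2 * B 0 2 + A 0 1 * B 0 1 + A 1 1 * B 1 1 + A 1 2 * B 1 2 + A 0 2 * B 0 2 + A 1 2 * B 1 2
          + (-A 0 0 - A 1 1) * (-B 0 0 - B 1 1)) * A 0 0 := by
    linear_combination (-A 0 0 - 2*A 1 1) * h0 + (A 0 0) * h1 + (-A 0 0) * h2 + (A 0 0/3 + A 0 2/3 + 2*A 1 1/3 + 2*A 1 2/3) * h3
      + (A 0 0/3 - A 0 1/3 + 2*A 1 1/3 - 2*A 1 2/3) * h4 + (A 0 0/3 - 2*A 0 1/3 + 2*A 0 2/3 + 2*A 1 1/3) * h5 + (-A 0 2) * h6 + (A 0 1) * h7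
      + (-A 0 0/3 - 2*A 1 1/3) * h9
  have t01 : ((A 0 0)^2 + (A 0 1)^2 + (A 0 2)^2 + (A 0 1)^2 + (A 1 1)^2 + (A 1 2)^2 + (A 0 2)^2 + (A 1 2)^2 + (-A 0 0 - A 1 1)^2) * B 0 1
      = (A 0 0 * B 0 0 + A 0 1 * B 0 1 + A 0 2 * B 0 2 + A 0 1 * B 0 1 + A 1 1 * B 1 1 + A 1 2 * B 1 2 + A 0 2 * B 0 2 + A 1 2 * B 1 2
          + (-A 0 0 - A 1 1) * (-B 0 0 - B 1 1)) * A 0 1 := by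
    linear_combination (-2*A 0 2) * h0 + (2*A 1 2) * h1 + (A 0 0/2) * h4 + (-A 1 1/2) * h5 + (-A 0 0/2) * h7 + (A 1 1/2) * h8
  have t02 : ((A 0 0)^2 + (A 0 1)^2 + (A 0 2)^2 + (A 0 1)^2 + (A 1 1)^2 + (A 1 2)^2 + (A 0 2)^2 + (A 1 2)^2 + (-A 0 0 - A 1 1)^2) * B 0 2
      = (A 0 0 * B 0 0 + A 0 1 * B 0 1 + A 0 2 * B 0 2 + A 0 1 * B 0 1 + A 1 1 * B 1 1 + A 1 2 * B 1 2 + A 0 2 * B 0 2 + A 1 2 * B 1 2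
          + (-A 0 0 - A 1 1) * (-B 0 0 - B 1 1)) * A 0 2 := by
    linear_combination (2*A 0 1) * h0 + (-2*A 1 2) * h2 + (-A 0 0/2) * h3 + (-A 0 0/2 - A 1 1/2) * h5 + (A 0 0/2) * h6 + (-A 0 0/2 - A 1 1/2) * h8
  have t11 : ((A 0 0)^2 + (A 0 1)^2 + (A 0 2)^2 + (A 0 1)^2 + (A 1 1)^2 + (A 1 2)^2 + (A 0 2)^2 + (A 1 2)^2 + (-A 0 0 - A 1 1)^2) * B 1 1
      = (A 0 0 * B 0 0 + A 0 1 * B 0 1 + A 0 2 * B 0 2 + A 0 1 * B 0 1 + A 1 1 * B 1 1 + A 1 2 * B 1 2 + A 0 2 * B 0 2 + A 1 2 * B 1 2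
          + (-A 0 0 - A 1 1) * (-B 0 0 - B 1 1)) * A 1 1 := by
    linear_combination (4*A 0 0 + A 1 1) * h0 + (4*A 0 0 + 5*A 1 1) * h1 + (-5*A 1 1) * h2
      + (-2*A 0 0/3 + 2*A 0 1 + 4*A 0 2/3 - A 1 1/3 - 4*A 1 2/3) * h3 + (-2*A 0 0/3 + 5*A 0 1/3 + 2*A 0 2 - A 1 1/3 - 2*A 1 2/3) * h4
      + (-2*A 0 0/3 + 4*A 0 1/3 + 2*A 0 2/3 - A 1 1/3 + 2*A 1 2) * h5 + (2*A 0 2) * h6 + (A 0 1) * h7 + (2*A 0 0/3 + A 1 1/3) * h9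
  have t12 : ((A 0 0)^2 + (A 0 1)^2 + (A 0 2)^2 + (A 0 1)^2 + (A 1 1)^2 + (A 1 2)^2 + (A 0 2)^2 + (A 1 2)^2 + (-A 0 0 - A 1 1)^2) * B 1 2
      = (A 0 0 * B 0 0 + A 0 1 * B 0 1 + A 0 2 * B 0 2 + A 0 1 * B 0 1 + A 1 1 * B 1 1 + A 1 2 * B 1 2 + A 0 2 * B 0 2 + A 1 2 * B 1 2
          + (-A 0 0 - A 1 1) * (-B 0 0 - B 1 1)) * A 1 2 := by
    linear_combination (-2*A 0 1) * h1 + (2*A 0 2) * h2 + (A 1 1/2) * h3 + (A 0 0/2 + A 1 1/2) * h4 + (A 1 1/2) * h6 + (A 0 0/2 + A 1 1/2) * h7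
  -- opaque names for the two invariants
  obtain ⟨S, hS⟩ : ∃ S : ℝ, S = ∑ k, ∑ l, A k l * A k l := ⟨_, rfl⟩
  obtain ⟨T, hT⟩ : ∃ T : ℝ, T = ∑ k, ∑ l, A k l * B k l := ⟨_, rfl⟩
  rw [← hS, ← hT]
  have hS' : S = (A 0 0)^2 + (A 0 1)^2 + (A 0 2)^2 + (A 0 1)^2 + (A 1 1)^2 + (A 1 2)^2 + (A 0 2)^2 + (A 1 2)^2 + (-A 0 0 - A 1 1)^2 := by
    rw [hS]; simp only [Fin.sum_univ_three]; rw [hA10, hA20, hA21, hA22]; ring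
  have hT' : T = A 0 0 * B 0 0 + A 0 1 * B 0 1 + A 0 2 * B 0 2 + A 0 1 * B 0 1 + A 1 1 * B 1 1 + A 1 2 * B 1 2 + A 0 2 * B 0 2 + A 1 2 * B 1 2
      + (-A 0 0 - A 1 1) * (-B 0 0 - B 1 1) := by
    rw [hT]; simp only [Fin.sum_univ_three]; rw [hA10, hA20, hA21, hA22, hB10, hB20, hB21, hB22]; ring
  have u00 : S * B 0 0 = T * A 0 0 := by rw [hS', hT']; linear_combination t00
  have u01 : S * B 0 1 = T * A 0 1 := by rw [hS', hT']; linear_combination t01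
  have u02 : S * B 0 2 = T * A 0 2 := by rw [hS', hT']; linear_combination t02
  have u11 : S * B 1 1 = T * A 1 1 := by rw [hS', hT']; linear_combination t11
  have u12 : S * B 1 2 = T * A 1 2 := by rw [hS', hT']; linear_combination t12
  fin_cases i <;> fin_cases j <;> simp only [Fin.zero_eta, Fin.mk_one, Fin.isValue, Fin.reduceFinMk]
  · exact u00
  · exact u01
  · exact u02
  · rw [hA10, hB10]; exact u01
  · exact u11
  · exact u12
  · rw [hA20, hB20]; exact u02
  · rw [hA21, hB21]; exact u12
  · rw [hA22, hB22]; linear_combination (-1 : ℝ) * u00 - u11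

/-! ## Smooth models of an admissible family (shared bookkeeping) -/

/-- A function continuous at `0` that vanishes on `(0,∞)` vanishes at `0`. -/
theorem eq_zero_of_Ioi {m : ℝ → ℝ} (hm : ContinuousAt m 0) (h : ∀ s : ℝ, 0 < s → m s = 0) : m 0 = 0 := by
  have h1 : Tendsto m (𝓝[>] (0 : ℝ)) (𝓝 (m 0)) := hm.tendsto.mono_left nhdsWithin_le_nhds
  have h2 : Tendsto m (𝓝[>] (0 : ℝ)) (𝓝 0) := by
    have hev : (fun _ => (0 : ℝ)) =ᶠ[𝓝[>] (0 : ℝ)] m := by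
      filter_upwards [self_mem_nhdsWithin] with s hs
      exact (h s hs).symm
    exact Tendsto.congr' hev tendsto_const_nhds
  exact tendsto_nhds_unique h1 h2

/-! ## Steps 2–3 and the assembly -/

/-- **S-A `AnalyticWedgeSeparable` holds.** -/
theorem analyticWedgeSeparable_holds : AnalyticWedgeSeparable := by
  intro Q hQa han hW
  obtain ⟨hqf, ⟨q, hq, hQq⟩, ⟨C, hC⟩⟩ := hQa
  -- smooth global models of the entries and of their radial derivatives
  set qe : Fin 3 → Fin 3 → ℝ → ℝ := fun i j s => q (s ^ 2) i j with hqe_def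
  have hqe : ∀ i j, ContDiff ℝ (⊤ : ℕ∞) (qe i j) := fun i j => (hq i j).comp (contDiff_id.pow 2)
  have hqed : ∀ i j, Differentiable ℝ (qe i j) := fun i j => (hqe i j).differentiable (by simp)
  have hqec : ∀ i j, Continuous (qe i j) := fun i j => (hqed i j).continuous
  set de : Fin 3 → Fin 3 → ℝ → ℝ := fun i j s => deriv (qe i j) s with hde_def
  have hdec : ∀ i j, Continuous (de i j) := by
    intro i j
    have h := (hqe i j).iterate_deriv 1
    simp only [Function.iterate_one] at h
    exact (h : ContDiff ℝ (⊤ : ℕ∞) (deriv (qe i j))).continuous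
  have hQe : ∀ s : ℝ, 0 ≤ s → ∀ i j, Q s i j = qe i j s := fun s hs i j => by
    show Q s i j = q (s ^ 2) i j
    rw [hQq s hs]
  have hQev : ∀ s : ℝ, 0 < s → ∀ i j, (fun s' => Q s' i j) =ᶠ[𝓝 s] qe i j := fun s hs i j => by
    filter_upwards [Ioi_mem_nhds hs] with s' hs'
    exact hQe s' hs'.le i j
  have hDe : ∀ s : ℝ, 0 < s → ∀ i j, radDeriv Q s i j = de i j s := by
    intro s hs i j
    simp only [radDeriv, Matrix.of_apply, hde_def]
    exact (hQev s hs i j).deriv_eq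
  have hQd : ∀ s : ℝ, 0 < s → ∀ i j, HasDerivAt (fun s' => Q s' i j) (de i j s) s := fun s hs i j =>
    ((hqed i j s).hasDerivAt).congr_of_eventuallyEq (hQev s hs i j)
  -- the radial derivative of an admissible family is again trace-free symmetric (on `(0,∞)`)
  have hDq : ∀ s : ℝ, 0 < s → IsQuadForm (radDeriv Q s) := by
    intro s hs
    refine ⟨?_, ?_⟩
    · ext i j
      simp only [Matrix.transpose_apply, radDeriv, Matrix.of_apply]
      refine Filter.EventuallyEq.deriv_eq ?_
      filter_upwards [Ioi_mem_nhds hs] with s' hs'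
      have hsy := (hqf s' hs'.le).1
      unfold Matrix.IsSymm at hsy
      exact congrFun (congrFun hsy i) j
    · rw [Matrix.trace, Fin.sum_univ_three]
      simp only [Matrix.diag_apply, radDeriv, Matrix.of_apply]
      have hsum : deriv (fun s' => Q s' 0 0 + Q s' 1 1 + Q s' 2 2) s = 0 := by
        have hev : (fun s' => Q s' 0 0 + Q s' 1 1 + Q s' 2 2) =ᶠ[𝓝 s] fun _ => (0 : ℝ) := by
          filter_upwards [Ioi_mem_nhds hs] with s' hs'
          have htr := (hqf s' hs'.le).2
          rw [Matrix.trace, Fin.sum_univ_three] at htr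
          simpa only [Matrix.diag_apply] using htr
        rw [hev.deriv_eq, deriv_const]
      have e1 : HasDerivAt (fun s' => Q s' 0 0 + Q s' 1 1 + Q s' 2 2) (de 0 0 s + de 1 1 s + de 2 2 s) s :=
        ((hQd s hs 0 0).add (hQd s hs 1 1)).add (hQd s hs 2 2)
      rw [(hQd s hs 0 0).deriv, (hQd s hs 1 1).deriv, (hQd s hs 2 2).deriv, ← e1.deriv, hsum]
  -- Step 1 at every radius: `|Q|² Q′ = ⟪Q,Q′⟫ Q` on `(0,∞)`
  have hpar : ∀ s : ℝ, 0 < s → ∀ i j,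
      (∑ k, ∑ l, Q s k l * Q s k l) * radDeriv Q s i j = (∑ k, ∑ l, Q s k l * radDeriv Q s k l) * Q s i j :=
    fun s hs i j => wedge_parallel (hqf s hs.le) (hDq s hs) (wedgeDet_eq_zero_of_sphere (hW s hs)) i j
  by_cases hzero : ∀ r : ℝ, 0 < r → Q r = 0
  · -- Case A: `Q ≡ 0`
    refine ⟨fun _ => 0, 0, ⟨⟨fun _ => 0, contDiff_const, fun r _ => rfl⟩, 0, fun r _ => ?_⟩, ⟨?_, ?_⟩, fun r hr => ?_⟩
    · simp
    · unfold Matrix.IsSymm; simp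
    · simp
    · rw [zero_smul]
      rcases hr.lt_or_eq with hr' | hr'
      · exact hzero r hr'
      · rw [← hr']
        ext i j
        rw [Matrix.zero_apply, hQe 0 le_rfl i j]
        refine eq_zero_of_Ioi (hqed i j).continuous.continuousAt fun s hs => ?_
        rw [← hQe s hs.le i j, hzero s hs, Matrix.zero_apply]
  · -- Case B: a non-zero value `Cm = Q r₀`
    push Not at hzero
    obtain ⟨r₀, hr₀, hQ0⟩ := hzero
    set Cm : Matrix (Fin 3) (Fin 3) ℝ := Q r₀ with hCm_def
    obtain ⟨i₀, j₀, hc⟩ : ∃ i j, Cm i j ≠ 0 := by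
      by_contra hcon
      push Not at hcon
      exact hQ0 (Matrix.ext fun i j => by rw [Matrix.zero_apply]; exact hcon i j)
    -- Step 2: every minor vanishes on a short interval to the right of `r₀`
    have hN0 : 0 < ∑ k, ∑ l, Cm k l * Cm k l := by
      have hle : Cm i₀ j₀ * Cm i₀ j₀ ≤ ∑ k, ∑ l, Cm k l * Cm k l := by
        have h1 : Cm i₀ j₀ * Cm i₀ j₀ ≤ ∑ l, Cm i₀ l * Cm i₀ l :=
          Finset.single_le_sum (f := fun l => Cm i₀ l * Cm i₀ l) (fun l _ => mul_self_nonneg _) (Finset.mem_univ j₀)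
        exact h1.trans (Finset.single_le_sum (f := fun k => ∑ l, Cm k l * Cm k l)
          (fun k _ => Finset.sum_nonneg fun l _ => mul_self_nonneg _) (Finset.mem_univ i₀))
      exact lt_of_lt_of_le (mul_self_pos.2 hc) hle
    -- continuous models of `|Q|²` and `⟪Q,Q′⟫`
    set Nn : ℝ → ℝ := fun s => ∑ k, ∑ l, qe k l s * qe k l s with hNn_def
    set Mm : ℝ → ℝ := fun s => ∑ k, ∑ l, qe k l s * de k l s with hMm_def
    have hNc : Continuous Nn := by
      simp only [hNn_def]
      fun_prop
    have hMc : Continuous Mm := by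
      simp only [hMm_def]
      fun_prop
    have hNQ : ∀ s : ℝ, 0 < s → (∑ k, ∑ l, Q s k l * Q s k l) = Nn s := fun s hs => by
      simp only [hNn_def, hQe s hs.le]
    have hMQ : ∀ s : ℝ, 0 < s → (∑ k, ∑ l, Q s k l * radDeriv Q s k l) = Mm s := fun s hs => by
      simp only [hMm_def, hQe s hs.le, hDe s hs]
    have hNr₀ : Nn r₀ = ∑ k, ∑ l, Cm k l * Cm k l := by rw [← hNQ r₀ hr₀]
    -- a short interval `[r₀, r₀ + η]` with `Nn ≥ N₀/2` and `|Mm| ≤ M₀`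
    obtain ⟨η, hη, hηN, hηM⟩ : ∃ η : ℝ, 0 < η ∧ (∀ s ∈ Icc r₀ (r₀ + η), Nn r₀ / 2 ≤ Nn s) ∧
        ∀ s ∈ Icc r₀ (r₀ + η), |Mm s| ≤ |Mm r₀| + 1 := by
      have e1 : ∀ᶠ s in 𝓝 r₀, Nn r₀ / 2 < Nn s :=
        (hNc.continuousAt (x := r₀)).tendsto.eventually_const_lt (by rw [hNr₀]; linarith)
      have e2 : ∀ᶠ s in 𝓝 r₀, |Mm s| < |Mm r₀| + 1 :=
        ((continuous_abs.comp hMc).continuousAt (x := r₀)).tendsto.eventually_lt_const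
          (by show |Mm r₀| < |Mm r₀| + 1; linarith)
      obtain ⟨ε, hε, hball⟩ := Metric.eventually_nhds_iff.1 (e1.and e2)
      refine ⟨ε / 2, by linarith, fun s hs => ?_, fun s hs => ?_⟩
      · have hd : dist s r₀ < ε := by
          rw [Real.dist_eq, abs_of_nonneg (by linarith [hs.1])]; linarith [hs.2]
        exact (hball hd).1.le
      · have hd : dist s r₀ < ε := by
          rw [Real.dist_eq, abs_of_nonneg (by linarith [hs.1])]; linarith [hs.2]
        exact (hball hd).2.le
    set K : ℝ := (|Mm r₀| + 1) / (Nn r₀ / 2) with hK_def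
    have hminor_loc : ∀ i j k l, ∀ s ∈ Icc r₀ (r₀ + η), Q s i j * Cm k l - Q s k l * Cm i j = 0 := by
      intro i j k l
      set f : ℝ → ℝ := fun s => Q s i j * Cm k l - Q s k l * Cm i j with hf_def
      set f' : ℝ → ℝ := fun s => de i j s * Cm k l - de k l s * Cm i j with hf'_def
      have hpos : ∀ s ∈ Icc r₀ (r₀ + η), 0 < s := fun s hs => hr₀.trans_le hs.1
      have hfc : ContinuousOn f (Icc r₀ (r₀ + η)) := by
        have hmodel : ContinuousOn (fun s => qe i j s * Cm k l - qe k l s * Cm i j) (Icc r₀ (r₀ + η)) :=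
          (((hqec i j).mul continuous_const).sub ((hqec k l).mul continuous_const)).continuousOn
        refine hmodel.congr fun s hs => ?_
        show Q s i j * Cm k l - Q s k l * Cm i j = qe i j s * Cm k l - qe k l s * Cm i j
        rw [hQe s (hpos s hs).le, hQe s (hpos s hs).le]
      have hfd : ∀ s ∈ Ico r₀ (r₀ + η), HasDerivWithinAt f (f' s) (Ici s) s := by
        intro s hs
        have hs0 : 0 < s := hr₀.trans_le hs.1
        exact (((hQd s hs0 i j).mul_const (Cm k l)).sub ((hQd s hs0 k l).mul_const (Cm i j))).hasDerivWithinAt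
      have hf0 : ‖f r₀‖ ≤ 0 := by
        show ‖Q r₀ i j * Cm k l - Q r₀ k l * Cm i j‖ ≤ 0
        rw [hCm_def]; simp [mul_comm]
      have hbound : ∀ s ∈ Ico r₀ (r₀ + η), ‖f' s‖ ≤ K * ‖f s‖ + 0 := by
        intro s hs
        have hs0 : 0 < s := hr₀.trans_le hs.1
        have hsI : s ∈ Icc r₀ (r₀ + η) := ⟨hs.1, hs.2.le⟩
        -- `Nn s * f' s = Mm s * f s`
        have hkey : Nn s * f' s = Mm s * f s := by
          have h1 := hpar s hs0 i j
          have h2 := hpar s hs0 k l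
          rw [hNQ s hs0, hMQ s hs0, hDe s hs0] at h1 h2
          show Nn s * (de i j s * Cm k l - de k l s * Cm i j) = Mm s * (Q s i j * Cm k l - Q s k l * Cm i j)
          linear_combination (Cm k l) * h1 - (Cm i j) * h2
        have hNs : Nn r₀ / 2 ≤ Nn s := hηN s hsI
        have hNs_pos : 0 < Nn s := lt_of_lt_of_le (by rw [hNr₀]; linarith) hNs
        have hMs : |Mm s| ≤ |Mm r₀| + 1 := hηM s hsI
        rw [add_zero, Real.norm_eq_abs, Real.norm_eq_abs]
        have e1 : |f' s| = |Mm s| * |f s| / Nn s := by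
          rw [eq_div_iff hNs_pos.ne', ← abs_mul, ← hkey, abs_mul, abs_of_pos hNs_pos, mul_comm]
        rw [e1, div_le_iff₀ hNs_pos, hK_def]
        have hN0' : 0 < Nn r₀ / 2 := by rw [hNr₀]; linarith
        have e2 : (|Mm r₀| + 1) / (Nn r₀ / 2) * |f s| * (Nn r₀ / 2) = (|Mm r₀| + 1) * |f s| := by
          rw [mul_comm _ (|f s|), mul_assoc, div_mul_cancel₀ _ hN0'.ne', mul_comm]
        calc |Mm s| * |f s| ≤ (|Mm r₀| + 1) * |f s| := mul_le_mul_of_nonneg_right hMs (abs_nonneg _)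
          _ = (|Mm r₀| + 1) / (Nn r₀ / 2) * |f s| * (Nn r₀ / 2) := e2.symm
          _ ≤ (|Mm r₀| + 1) / (Nn r₀ / 2) * |f s| * Nn s :=
            mul_le_mul_of_nonneg_left hNs (mul_nonneg (div_nonneg (by positivity) hN0'.le) (abs_nonneg _))
      have hG := norm_le_gronwallBound_of_norm_deriv_right_le hfc hfd hf0 hbound
      intro s hs
      have h1 := hG s hs
      rw [gronwallBound_ε0_δ0] at h1
      exact norm_le_zero_iff.1 h1
    -- Step 3: analytic continuation to all of `(0,∞)`
    have hminor : ∀ i j k l, ∀ s : ℝ, 0 < s → Q s i j * Cm k l - Q s k l * Cm i j = 0 := by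
      intro i j k l s hs
      set g : ℝ → ℝ := fun s => Q s i j * Cm k l - Q s k l * Cm i j with hg_def
      have hga : AnalyticOnNhd ℝ g (Ioi 0) :=
        ((han i j).mul analyticOnNhd_const).sub ((han k l).mul analyticOnNhd_const)
      have hz₁ : r₀ + η / 2 ∈ Ioi (0 : ℝ) := by
        show (0 : ℝ) < r₀ + η / 2
        linarith
      have hev : g =ᶠ[𝓝 (r₀ + η / 2)] 0 := by
        filter_upwards [Ioo_mem_nhds (show r₀ < r₀ + η / 2 by linarith) (show r₀ + η / 2 < r₀ + η by linarith)] with s' hs'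
        exact hminor_loc i j k l s' ⟨hs'.1.le, hs'.2.le⟩
      have h2 := hga.eqOn_zero_of_preconnected_of_eventuallyEq_zero isPreconnected_Ioi hz₁ hev hs
      simpa only [hg_def, Pi.zero_apply] using h2
    -- extension to `r = 0` by continuity
    have hminor0 : ∀ i j k l, ∀ s : ℝ, 0 ≤ s → Q s i j * Cm k l - Q s k l * Cm i j = 0 := by
      intro i j k l s hs
      rcases hs.lt_or_eq with hs' | hs'
      · exact hminor i j k l s hs'
      · rw [← hs', hQe 0 le_rfl, hQe 0 le_rfl]
        refine eq_zero_of_Ioi (m := fun s => qe i j s * Cm k l - qe k l s * Cm i j)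
          (((hqec i j).mul continuous_const).sub ((hqec k l).mul continuous_const)).continuousAt fun s' hs'' => ?_
        show qe i j s' * Cm k l - qe k l s' * Cm i j = 0
        rw [← hQe s' hs''.le, ← hQe s' hs''.le]
        exact hminor i j k l s' hs''
    -- the profile
    set c : ℝ := Cm i₀ j₀ with hc_def
    set H : ℝ → ℝ := fun s => Q s i₀ j₀ / c with hH_def
    refine ⟨H, Cm, ⟨⟨fun s => q s i₀ j₀ / c, (hq i₀ j₀).div_const c, fun r hr => ?_⟩, ?_⟩, hqf r₀ hr₀.le, fun r hr => ?_⟩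
    · show Q r i₀ j₀ / c = q (r ^ 2) i₀ j₀ / c
      rw [hQq r hr]
    · refine ⟨C / |c|, fun r hr => ⟨?_, ?_, ?_⟩⟩
      · have h1 := (hC r hr i₀ j₀).1
        show r ^ 5 * |Q r i₀ j₀ / c| ≤ C / |c|
        rw [abs_div, ← mul_div_assoc]
        exact div_le_div_of_nonneg_right h1 (abs_nonneg _)
      · have h1 := (hC r hr i₀ j₀).2.1
        have e1 : deriv H r = deriv (fun s => Q s i₀ j₀) r / c := by
          show deriv (fun s => Q s i₀ j₀ / c) r = _
          exact deriv_div_const _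
        rw [e1, abs_div, ← mul_div_assoc]
        exact div_le_div_of_nonneg_right h1 (abs_nonneg _)
      · have h1 := (hC r hr i₀ j₀).2.2
        have e1 : deriv H = fun r => deriv (fun s => Q s i₀ j₀) r / c := by
          funext r
          show deriv (fun s => Q s i₀ j₀ / c) r = _
          exact deriv_div_const _
        have e2 : deriv (deriv H) r = deriv (deriv fun s => Q s i₀ j₀) r / c := by
          rw [e1]
          exact deriv_div_const _
        rw [e2, abs_div, ← mul_div_assoc]
        exact div_le_div_of_nonneg_right h1 (abs_nonneg _)
    · ext i j
      rw [Matrix.smul_apply, smul_eq_mul]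
      show Q r i j = Q r i₀ j₀ / c * Cm i j
      have h1 := hminor0 i j i₀ j₀ r hr
      field_simp
      linear_combination h1

end Summit.NavierStokesRegularity.NavierStokesRegularity.Theorems.UnthreadedRigidity.PressureHorn

end
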